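import Mathlib
import Summits.ResolutionOfSingularities.ResolutionOfSingularities.Theorems.HomologicalConductorPersistenceSurfaceFiniteCover
import Summits.ResolutionOfSingularities.ResolutionOfSingularities.Theorems.HomologicalConductorPersistenceSurfaceRational
import Summits.ResolutionOfSingularities.ResolutionOfSingularities.Theorems.HomologicalConductorPersistenceStandardEtaleAscent
import Summits.ResolutionOfSingularities.ResolutionOfSingularities.Theorems.HomologicalConductorNoZenoTowerNoetherian
import Literature.RingTheory.CohomologyAnnihilator.Completion
import HarnessLib

/-!
# Rung S-2 `PersistenceSurface` (stmt-ResolutionOfSingularities-19970) — ORDER w44b-o8: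
# the RATIONAL-STEP ASSEMBLY `RationalStepDualCover → LevelFourPersistenceRational`

Route `ResolutionOfSingularities/HomologicalConductor`, chain W4.4b (cell res-hironaka; seat res-D-pv-043 on
res-L1-w44b-plan-1 g9's ORDER w44b-o8, pre-announced 2026-08-27T06:44:08Z). OURS; nothing here is a
statement of the manuscript under review (Hironaka 2017); AI-written, weaker than expert review.

Programme M-rat₄ (CRUX-PLAN v7 §2.3) proves level-four persistence `ca⁴(T_m) ⊆ ca⁴(T_(m+1))` at a RATIONAL
step of a surface tower in four moves: (1) pass to an étale neighbourhood `T₁` of `T_m` with the same index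
(o5, `…PersistenceStandardEtaleAscent`, p504897); (2) there, `x ∈ ca⁴` stably annihilates every third syzygy,
in particular the finitely many modules `Y_l` realising the specials (W4.4 CA1
`mem_cohomologyAnnihilatorOfDegree_succ_iff_forall_isSyzygy`, p497920); (3) over a common algebra `T''`
(the completion of `T_(m+1)`) the single duals `(T'' ⊗ Y_l)*` and a free module cover every third syzygy
up to retracts — this is (E-sur) + (IW-p), packed as FC-4's hypothesis `hcover`
(`map_mem_cohomologyAnnihilatorOfDegree_succ_of_finiteDualCover`, p504042) — so `x ∈ ca⁴(T'')`; (4) descend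
`ca⁴(T'') ∩ T_(m+1) ⊆ ca⁴(T_(m+1))` (BHST 2015 Thm 4.5 (1), named fact `caCompletion_comap_le`, p479882).

This file TYPES that shape and proves the composition, so that the rung's rational half
`LevelFourPersistenceRational` (o6, p505465) follows from ONE typed premise:

* `algebraMap_mem_cohomologyAnnihilatorOfDegree_succ_of_stepDualCover` — the ABSTRACT STEP at any level
  `n + 1`: ascent `(caⁿ⁺¹ T) T₁ ⊆ caⁿ⁺¹ T₁`, a commuting square `T → T₁ → T''`, `T → T' → T''`, descent
  `caⁿ⁺¹(T'') ∩ T' ⊆ caⁿ⁺¹(T')`, `n`-th-syzygy modules `Y j` over `T₁` with FC-4's `hcover` over `T''`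
  ⊢ `caⁿ⁺¹(T) T' ⊆ caⁿ⁺¹(T')` elementwise (ascent ⇒ CA1 ⇒ FC-4 ⇒ descent);
* `HasStepDualCover T T'` — the level-four instance of those data as ONE predicate on a ring map `T → T'`
  (the ascent / descent conditions are SEMANTIC conjuncts; `hasc_of_etaleNeighbourhood` and
  `hdesc_completion` discharge them for étale neighbourhoods (o5) and for the completion (modulo the
  named fact `caCompletion_comap_le`) respectively);
* `algebraMap_mem_cohomologyAnnihilatorOfDegree_four_of_hasStepDualCover`,
  `map_cohomologyAnnihilatorOfDegree_four_le_of_hasStepDualCover` — `ca⁴(T) T' ⊆ ca⁴(T')`;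
* `mem_caAt_iff` — the route's `let caAt` is `cohomologyAnnihilatorOfDegree` of the stage;
* `RationalStepDualCover` (`@[conjecture]`, OURS) — every step of a surface tower whose stage `0` is
  rational or regular has a level-four dual cover (binders verbatim those of `LevelFourPersistenceRational`;
  in print for `k = k̄` of characteristic `0`: Wunram 1988 + Iyama–Wemyss Thm 2.4; premise (IW-p) in
  characteristic `p`);
* `levelFourPersistenceRational_of_rationalStepDualCover : RationalStepDualCover → LevelFourPersistenceRational`
  — THE ASSEMBLY (re-abstraction of the route's `let`s around the step theorem).

References: S. B. Iyengar, R. Takahashi, *Annihilation of cohomology and strong generation of module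
categories*, IMRN 2016, arXiv:1404.1476 [`IyengarTakahashi2014`]; A. Bahlekeh, E. Hakimian, S. Salarian,
R. Takahashi, *Annihilation of cohomology, generation of modules and finiteness of derived dimension*,
2015, Thm 4.5 [`BahlekehHakimianSalarianTakahashi2015`].
-/

set_option linter.dupNamespace false

noncomputable section

open CategoryTheory Literature.RingTheory.CohomologyAnnihilator
open Summit.ResolutionOfSingularities.ResolutionOfSingularities.Theorems.NoZeno.SandwichCluster
open Summit.ResolutionOfSingularities.ResolutionOfSingularities.Theorems.NoZeno.Birth
open Summit.ResolutionOfSingularities.ResolutionOfSingularities.Theorems.HomologicalConductor.PersistenceSurfaceFiniteCover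
open Summit.ResolutionOfSingularities.ResolutionOfSingularities.Theorems.HomologicalConductor.PersistenceSurfaceRational
open Summit.ResolutionOfSingularities.ResolutionOfSingularities.Theorems.HomologicalConductor.PersistenceStandardEtaleAscent
open scoped TensorProduct

namespace Summit.ResolutionOfSingularities.ResolutionOfSingularities.Theorems.HomologicalConductor.PersistenceSurfaceRationalAssembly

universe u

/-! ## The abstract step -/

/-- **The abstract step (OURS · w44b-o8).** `T → T'` a ring map (one tower step), `T → T₁` an
auxiliary noetherian algebra with level-`(n+1)` ASCENT `caⁿ⁺¹(T) T₁ ⊆ caⁿ⁺¹(T₁)` (e.g. an étale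
neighbourhood, o5), `T''` a common noetherian `T₁`- and `T'`-algebra (the square commuting on `T`) with
level-`(n+1)` DESCENT `caⁿ⁺¹(T'') ∩ T' ⊆ caⁿ⁺¹(T')` (e.g. a completion, BHST 4.5 (1)), and finitely many
`n`-th-syzygy `T₁`-modules `Y j` whose base-changed single duals `(T'' ⊗ Y j)*`, with a free module, cover
every `n`-th syzygy over `T''` up to linear retracts (FC-4's `hcover`). Then `algebraMap T T' x ∈ caⁿ⁺¹(T')`
for every `x ∈ caⁿ⁺¹(T)`: ascent ⇒ CA1 (`x` stably annihilates each `Y j`) ⇒ FC-4 ⇒ descent.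
[cite: IyengarTakahashi2014, Remark 2.13] -/
theorem algebraMap_mem_cohomologyAnnihilatorOfDegree_succ_of_stepDualCover
    {T T' T₁ T'' : Type u} [CommRing T] [CommRing T'] [CommRing T₁] [CommRing T'']
    [Algebra T T'] [Algebra T T₁] [Algebra T₁ T''] [Algebra T' T'']
    [IsNoetherianRing T₁] [IsNoetherianRing T''] (n : ℕ) {x : T}
    (hx : x ∈ cohomologyAnnihilatorOfDegree T (n + 1))
    (hasc : (cohomologyAnnihilatorOfDegree T (n + 1)).map (algebraMap T T₁) ≤
      cohomologyAnnihilatorOfDegree T₁ (n + 1))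
    (hsq : ∀ t : T, algebraMap T₁ T'' (algebraMap T T₁ t) = algebraMap T' T'' (algebraMap T T' t))
    (hdesc : (cohomologyAnnihilatorOfDegree T'' (n + 1)).comap (algebraMap T' T'') ≤
      cohomologyAnnihilatorOfDegree T' (n + 1))
    {ι : Type} [Fintype ι] (Y : ι → ModuleCat.{u} T₁)
    (hY : ∀ j, ∃ M : ModuleCat.{u} T₁, Module.Finite T₁ M ∧ IsSyzygy n M (Y j))
    (hcover : ∀ (M L : ModuleCat.{u} T''), Module.Finite T'' M → IsSyzygy n M L →
      ∃ (a : ℕ) (b : ι → ℕ)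
        (i : L →ₗ[T''] ((Fin a → T'') × (Π j, Fin (b j) → Module.Dual T'' (T'' ⊗[T₁] Y j))))
        (r : ((Fin a → T'') × (Π j, Fin (b j) → Module.Dual T'' (T'' ⊗[T₁] Y j))) →ₗ[T''] L),
        r ∘ₗ i = LinearMap.id) :
    algebraMap T T' x ∈ cohomologyAnnihilatorOfDegree T' (n + 1) := by
  have h1 : algebraMap T T₁ x ∈ cohomologyAnnihilatorOfDegree T₁ (n + 1) :=
    hasc (Ideal.mem_map_of_mem _ hx)
  have h2 : ∀ j, StablyAnnihilates T₁ (algebraMap T T₁ x) (Y j) := fun j => by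
    obtain ⟨M, hM, hsyz⟩ := hY j
    exact (mem_cohomologyAnnihilatorOfDegree_succ_iff_forall_isSyzygy _).mp h1 M (Y j) hM hsyz
  have h3 : algebraMap T₁ T'' (algebraMap T T₁ x) ∈ cohomologyAnnihilatorOfDegree T'' (n + 1) :=
    map_mem_cohomologyAnnihilatorOfDegree_succ_of_finiteDualCover (algebraMap T T₁ x) n Y h2 hcover
  rw [hsq] at h3
  exact hdesc (Ideal.mem_comap.mpr h3)

/-! ## The step predicate -/

/-- **`HasStepDualCover T T'` (OURS · w44b-o8)** — a ring map `T → T'` (one tower step `T_m → T_(m+1)`)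
admits a LEVEL-FOUR DUAL COVER: there are
* a noetherian `T`-algebra `T₁` with level-4 ASCENT `ca⁴(T) T₁ ⊆ ca⁴(T₁)` (instances: étale
  neighbourhoods, o5 `map_cohomologyAnnihilatorOfDegree_le_of_isLocalization_of_etale`; see
  `hasc_of_etaleNeighbourhood` below),
* a noetherian common `T₁`- and `T'`-algebra `T''`, the square commuting on `T`, with level-4 DESCENT
  `ca⁴(T'') ∩ T' ⊆ ca⁴(T')` (instance: the completion of `T'`, named fact BHST 4.5 (1)
  `caCompletion_comap_le`; see `hdesc_completion` below),
* finitely many THIRD-SYZYGY `T₁`-modules `Y j` whose base-changed single duals `(T'' ⊗ Y j)*`, with a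
  free module, cover every third syzygy over `T''` up to linear retracts (FC-4's `hcover`, p504042).
At a rational step these are: `T₁` = an étale neighbourhood of `T_m` over which the specials of the
minimal resolution are defined, `Y_l` = the third syzygies realising the specials `M_l`, `T''` = the
completion of `T_(m+1)`, `hcover` = (E-sur) + (IW-p) (CRUX-PLAN v7 §2.3 steps (2)–(4)). NOT a statement
of the manuscript under study. [this work] -/
def HasStepDualCover (T T' : Type) [CommRing T] [CommRing T'] [Algebra T T'] : Prop :=
  ∃ (T₁ : Type) (_ : CommRing T₁) (_ : Algebra T T₁) (_ : IsNoetherianRing T₁)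
    (T'' : Type) (_ : CommRing T'') (_ : Algebra T₁ T'') (_ : Algebra T' T'') (_ : IsNoetherianRing T''),
    (cohomologyAnnihilatorOfDegree T 4).map (algebraMap T T₁) ≤ cohomologyAnnihilatorOfDegree T₁ 4 ∧
    (∀ t : T, algebraMap T₁ T'' (algebraMap T T₁ t) = algebraMap T' T'' (algebraMap T T' t)) ∧
    (cohomologyAnnihilatorOfDegree T'' 4).comap (algebraMap T' T'') ≤ cohomologyAnnihilatorOfDegree T' 4 ∧
    ∃ (ι : Type) (_ : Fintype ι) (Y : ι → ModuleCat.{0} T₁),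
      (∀ j, ∃ M : ModuleCat.{0} T₁, Module.Finite T₁ M ∧ IsSyzygy 3 M (Y j)) ∧
      ∀ (M L : ModuleCat.{0} T''), Module.Finite T'' M → IsSyzygy 3 M L →
        ∃ (a : ℕ) (b : ι → ℕ)
          (i : L →ₗ[T''] ((Fin a → T'') × (Π j, Fin (b j) → Module.Dual T'' (T'' ⊗[T₁] Y j))))
          (r : ((Fin a → T'') × (Π j, Fin (b j) → Module.Dual T'' (T'' ⊗[T₁] Y j))) →ₗ[T''] L),
          r ∘ₗ i = LinearMap.id

/-- **Level-four persistence across one step with a dual cover (OURS · w44b-o8).**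
`HasStepDualCover T T'` ⇒ `ca⁴(T) T' ⊆ ca⁴(T')` elementwise. [folklore] -/
theorem algebraMap_mem_cohomologyAnnihilatorOfDegree_four_of_hasStepDualCover
    {T T' : Type} [CommRing T] [CommRing T'] [Algebra T T'] (h : HasStepDualCover T T')
    {x : T} (hx : x ∈ cohomologyAnnihilatorOfDegree T 4) :
    algebraMap T T' x ∈ cohomologyAnnihilatorOfDegree T' 4 := by
  obtain ⟨T₁, _, _, _, T'', _, _, _, _, hasc, hsq, hdesc, ι, _, Y, hY, hcover⟩ := h
  exact algebraMap_mem_cohomologyAnnihilatorOfDegree_succ_of_stepDualCover 3 hx hasc hsq hdesc Y hY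
    hcover

/-- The same as an inclusion of ideals. [folklore] -/
theorem map_cohomologyAnnihilatorOfDegree_four_le_of_hasStepDualCover
    {T T' : Type} [CommRing T] [CommRing T'] [Algebra T T'] (h : HasStepDualCover T T') :
    (cohomologyAnnihilatorOfDegree T 4).map (algebraMap T T') ≤ cohomologyAnnihilatorOfDegree T' 4 := by
  rw [Ideal.map_le_iff_le_comap]
  intro x hx
  exact Ideal.mem_comap.mpr (algebraMap_mem_cohomologyAnnihilatorOfDegree_four_of_hasStepDualCover h hx)

/-! ## The two conjuncts from the landed bricks -/

/-- **Ascent conjunct from an étale neighbourhood (o5).** If `T₁` is a localisation of an étale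
algebra `S` over the noetherian ring `T`, then `ca⁴(T) T₁ ⊆ ca⁴(T₁)`
(`map_cohomologyAnnihilatorOfDegree_le_of_isLocalization_of_etale`, p504897). [folklore] -/
theorem hasc_of_etaleNeighbourhood {T S T₁ : Type} [CommRing T] [CommRing S] [CommRing T₁]
    [Algebra T S] [Algebra S T₁] [Algebra T T₁] [IsScalarTower T S T₁] [IsNoetherianRing T]
    [Algebra.Etale T S] (U : Submonoid S) [IsLocalization U T₁] :
    (cohomologyAnnihilatorOfDegree T 4).map (algebraMap T T₁) ≤ cohomologyAnnihilatorOfDegree T₁ 4 :=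
  map_cohomologyAnnihilatorOfDegree_le_of_isLocalization_of_etale T S T₁ U 3

/-- **Descent conjunct from the completion (named fact BHST 4.5 (1)).** For `T'` noetherian local and
`T'' = AdicCompletion 𝔪 T'`: `ca⁴(T'') ∩ T' ⊆ ca⁴(T')`, modulo the named fact
`caCompletion_comap_le` (p479882). [cite: BahlekehHakimianSalarianTakahashi2015, Theorem 4.5 (1)] -/
theorem hdesc_completion (h₁ : caCompletion_comap_le.{0}) {T' : Type} [CommRing T']
    [IsNoetherianRing T'] [IsLocalRing T'] :
    (cohomologyAnnihilatorOfDegree (AdicCompletion (IsLocalRing.maximalIdeal T') T') 4).comap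
        (algebraMap T' (AdicCompletion (IsLocalRing.maximalIdeal T') T')) ≤
      cohomologyAnnihilatorOfDegree T' 4 :=
  h₁ T' 4

/-! ## Along the tower -/

variable {k K : Type} [Field k] [Field K] [Algebra k K]

/-- The levelled annihilator of the route's `let caAt`, over a subalgebra `B ⊆ K`, is the image of
the tree's `cohomologyAnnihilatorOfDegree ↥B n`: for `g ∈ B`, `(g : K) ∈ caAt n B ↔ g ∈ caⁿ(↥B)`.
[cite: IyengarTakahashi2014, Definition 2.1] -/
theorem mem_caAt_iff (n : ℕ) (B : Subalgebra k K) (x : K) :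
    x ∈ {x : K | ∃ hx : x ∈ B, ∀ i : ℕ, n ≤ i → ∀ (M N : ModuleCat.{0} ↥B),
      Module.Finite ↥B M → Module.Finite ↥B N →
        ∀ e : CategoryTheory.Abelian.Ext.{0} M N i, (⟨x, hx⟩ : ↥B) • e = 0} ↔
      ∃ hx : x ∈ B, (⟨x, hx⟩ : ↥B) ∈ cohomologyAnnihilatorOfDegree ↥B n := by
  simp only [Set.mem_setOf_eq, mem_cohomologyAnnihilatorOfDegree_iff]

/-- **`RationalStepDualCover` (OURS · w44b-o8)** — the typed PREMISE of programme M-rat₄: along the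
canonical normalised `ca`-tower of a surface datum `(A, O)` (binders verbatim those of
`LevelFourPersistenceRational`, o6 p505465) whose stage `0` is rational or regular, EVERY step
`T_m → T_(m+1)` (with the inclusion as algebra structure; `hle` any proof of it) has a level-four dual
cover, `HasStepDualCover ↥T_m ↥T_(m+1)`. In characteristic `0` over an algebraically closed field this
is (E-sur) + (IW) in print (Wunram 1988; Iyama–Wemyss, Thm 2.4) with `T₁` an étale neighbourhood and
`T''` the completion; in characteristic `p` it carries the open premise (IW-p) (CRUX-PLAN v7 §2.3).
NOT a statement of the manuscript under study. -/
@[conjecture]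
def RationalStepDualCover : Prop :=
  ∀ p : ℕ, p.Prime → ∀ (k K : Type) [Field k] [CharP k p] [Field K] [Algebra k K]
    (O : ValuationSubring K) (A : Subalgebra k K), (∀ c : k, algebraMap k K c ∈ O) → A.FG →
    IsFractionRing ↥A K → A.toSubring ≤ O.toSubring → ringKrullDim ↥A ≤ 2 →
    (Literature.AlgebraicGeometry.Resolution.HasRationalSingularity ↥(tower O A 0) ∨
      IsRegularLocalRing ↥(tower O A 0)) →
    ∀ (m : ℕ) (hle : tower O A m ≤ tower O A (m + 1)),
      letI := (Subalgebra.inclusion hle).toRingHom.toAlgebra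
      HasStepDualCover ↥(tower O A m) ↥(tower O A (m + 1))

/-- **THE ASSEMBLY (OURS · w44b-o8): `RationalStepDualCover → LevelFourPersistenceRational`.**
For `x ∈ ca⁴(T_m)`: ascent to the étale-local `T₁`, CA1 (`x` stably annihilates every third syzygy
over `T₁`, in particular the `Y j`), FC-4 over `T''`, descent to `T_(m+1)` — all packed in
`algebraMap_mem_cohomologyAnnihilatorOfDegree_four_of_hasStepDualCover`; the rest re-abstracts the
route's `let`s (`tower`, `caAt` are verbatim `NoZeno.Birth.tower` and `caⁿ` of the stage). [folklore] -/
theorem levelFourPersistenceRational_of_rationalStepDualCover (h : RationalStepDualCover) :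
    LevelFourPersistenceRational := by
  intro p hp k K _ _ _ _ O A hk hA hfr hAO hdim caAt ca loc chart nrm tower' hR m x hx
  obtain ⟨hxT, hx4⟩ := hx
  -- `T_m ≤ T_(m+1) = loc (nrm (chart T_m))` (inline, as in `PersistenceOfSTD.persistence_of_STD`)
  have hle : tower O A m ≤ tower O A (m + 1) := fun y hy => by
    rw [tower_succ]
    exact SyzygyFlattening.self_le_locAt O _
      (SyzygyFlattening.self_le_nrm _ (Algebra.subset_adjoin (Or.inl hy)))
  letI := (Subalgebra.inclusion hle).toRingHom.toAlgebra
  have hstep : HasStepDualCover ↥(tower O A m) ↥(tower O A (m + 1)) :=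
    h p hp k K O A hk hA hfr hAO hdim hR m hle
  have hx' : (⟨x, hxT⟩ : ↥(tower O A m)) ∈ cohomologyAnnihilatorOfDegree ↥(tower O A m) 4 :=
    mem_cohomologyAnnihilatorOfDegree_iff.mpr hx4
  have hmem := algebraMap_mem_cohomologyAnnihilatorOfDegree_four_of_hasStepDualCover hstep hx'
  refine ⟨hle hxT, ?_⟩
  exact mem_cohomologyAnnihilatorOfDegree_iff.mp hmem

end Summit.ResolutionOfSingularities.ResolutionOfSingularities.Theorems.HomologicalConductor.PersistenceSurfaceRationalAssembly

end
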